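import Summits.ValiantsHypothesis.ValiantsHypothesis.Theses.BarrierLever
import Summits.ValiantsHypothesis.ValiantsHypothesis.Theorems.BarrierLeverChowStarveDead
import Summits.ValiantsHypothesis.ValiantsHypothesis.Theorems.BarrierLeverPartitionMinorsGenericChowProduct

/-!
# Route BarrierLever — REFUTATION of item `ChowHitsThinRowPartitionMinors` (stmt-ValiantsHypothesis-20195)

Prover file (cell valiant-natproofs, rung V4, 𝒟-side; seat val-np-p2 gen 9).  **Closes item 20195
NEGATIVELY**: `not_ChowHitsThinRowPartitionMinors : ¬ Theses.BarrierLever.ChowHitsThinRowPartitionMinors`.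

THE COUNTEREXAMPLE (memo HOME/val-np-p2/g9/REFUTATION-20195-valnp2-g9.md).  At every height
`n = 2o + 1` with `o ≥ 12` take as rows ALL subsets of `Fin n` of size `≤ 2` and as columns the same
sets except that every pair inside the STARVED block `O = {o+1, …, 2o}` is replaced by the triple
`{i − (o+1), j − (o+1), o} ⊆ K = {0, …, o}` (`starveColumn`); the columns are distinct, have size `≤ 3`,
never contain two elements of `O`, and the triples avoid `O`.  Then for EVERY family of `n + n`
polynomials of total degree `≤ 1` the partition minor `det[coeff_{x^{u i} y^{w j}} ∏ ℓ]` VANISHES: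

* generic coefficients (`no_chow_witness`): the minor of the GENERIC product
  (`ChowFactor.genericChow…`, indeterminate coefficients) is a polynomial `P` with `P · Q = 0` for the
  nonzero polynomial `Q = (∏_k c_k) · det(Σ_k (∏_{j≠k} c_j)² α_{ka} β_{kc})`, because at every point
  with `Q ≠ 0` the forms can be rescaled to constant term `1` with `det(Σ_k A k a B k c) ≠ 0`, where
  `…ChowStarveDead.det_thinLayout_eq_zero_of_constOne` applies (row-dependence certificate from a
  symmetric zero-diagonal `N ≠ 0` killing `𝕄 e`, `e ∈ K`; it exists since the `C(o+1,2)` symmetric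
  parameters on `O` exceed the `3n` linear constraints: `6o + 3 < o(o+1)/2` iff `o ≥ 12`);
* hence `P = 0`, so no specialisation — no family of affine forms whatsoever — hits the layout
  (`ChowFactor.genericChow_det_ne_zero_of_hit`).

Consequences (separate files): items 20172 `ChowHitsPartitionMinors` and 20239
`ChowHitsReadOnceDeterminants` are false as well (landed arrows 20239 ⇒ 20172 ⇒ 20195).
MECHANISM in words: the columns are thin 2-jets in `x`; their quadratic parts live in
`span{M_c M_d : cd an edge} + Σ_{d ∈ K} M_d · (linear) + span{α_k²}`, so the `C(o+1,2)` directions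
`M_a M_b` (`a, b ∈ O`) can only be fed by the `2n` squares modulo the `n` coordinate squares.

WHAT THIS IS NOT: nothing on item 19717 `PartitionMinorsHitByVP` (VP witnesses are far richer than
products of `n + n` affine forms — the dead layouts revive with ≈ `n²/2` forms), on crux
stmt-ValiantsHypothesis-14610, or on `VP` versus `VNP`.
-/

set_option linter.dupNamespace false

namespace Summit.ValiantsHypothesis.ValiantsHypothesis.Theorems.BarrierLever.ChowStarve

open Finset MvPolynomial
open Summit.ValiantsHypothesis.ValiantsHypothesis.Theorems.BarrierLever.ChowFactor
  (eval_det_coeff_genericChow genericChow_det_ne_zero_of_hit)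

variable {h : ℕ}

/-! ## 1. The genericity polynomial `Q` and a point where it does not vanish -/

/-- The test point: form `k < h` is `1 + x_k + y_k`, the other forms are `1`. -/
theorem eval_testPoint_D (a c : Fin h) :
    (∑ k : Fin (h + h), (∏ _j ∈ Finset.univ.erase k, (1 : ℂ)) ^ 2 *
        (if (k : ℕ) < h ∧ (((Fin.castAdd h a : Fin (h + h)) : ℕ) = (k : ℕ) ∨
            ((Fin.castAdd h a : Fin (h + h)) : ℕ) = h + (k : ℕ)) then (1 : ℂ) else 0) *
        (if (k : ℕ) < h ∧ (((Fin.natAdd h c : Fin (h + h)) : ℕ) = (k : ℕ) ∨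
            ((Fin.natAdd h c : Fin (h + h)) : ℕ) = h + (k : ℕ)) then (1 : ℂ) else 0)) =
      if a = c then 1 else 0 := by
  rw [Finset.sum_eq_single (Fin.castAdd h a)]
  · simp only [Finset.prod_const_one, one_pow, one_mul, Fin.val_castAdd, Fin.val_natAdd, Fin.is_lt,
      true_and, true_or, if_true]
    by_cases hac : a = c
    · subst hac; simp
    · rw [if_neg, if_neg hac]
      rintro (h1 | h1)
      · have := c.is_lt; omega
      · exact hac (Fin.ext (by omega))
  · intro k _ hk
    have hx : ¬ ((k : ℕ) < h ∧ (((Fin.castAdd h a : Fin (h + h)) : ℕ) = (k : ℕ) ∨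
        ((Fin.castAdd h a : Fin (h + h)) : ℕ) = h + (k : ℕ))) := by
      rintro ⟨hk1, hk2 | hk2⟩
      · exact hk (Fin.ext (by simp only [Fin.val_castAdd] at hk2 ⊢; omega))
      · simp only [Fin.val_castAdd] at hk2
        have := a.is_lt; omega
    rw [if_neg hx, mul_zero, zero_mul]
  · intro ha; exact absurd (Finset.mem_univ _) ha

/-- **The genericity polynomial is nonzero.** -/
theorem genericityPoly_ne_zero (h : ℕ) :
    ((∏ k : Fin (h + h), (X (k, none) : MvPolynomial (Fin (h + h) × Option (Fin (h + h))) ℂ)) *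
      (Matrix.of fun a c : Fin h => ∑ k : Fin (h + h),
        (∏ j ∈ Finset.univ.erase k, (X (j, none) : MvPolynomial (Fin (h + h) × Option (Fin (h + h))) ℂ)) ^ 2 *
          X (k, some (Fin.castAdd h a)) * X (k, some (Fin.natAdd h c))).det) ≠ 0 := by
  classical
  -- the test point
  let θ₀ : Fin (h + h) × Option (Fin (h + h)) → ℂ := fun p =>
    Option.elim p.2 1 (fun v => if (p.1 : ℕ) < h ∧ ((v : ℕ) = (p.1 : ℕ) ∨ (v : ℕ) = h + (p.1 : ℕ))
      then 1 else 0)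
  intro hzero
  have e := congrArg (eval θ₀) hzero
  rw [map_mul, map_zero, map_prod, RingHom.map_det] at e
  have e1 : ∏ k : Fin (h + h), eval θ₀ (X (k, none) : MvPolynomial (Fin (h + h) × Option (Fin (h + h))) ℂ)
      = 1 := Finset.prod_eq_one fun k _ => by rw [eval_X]; rfl
  have e2 : (RingHom.mapMatrix (eval θ₀)) (Matrix.of fun a c : Fin h => ∑ k : Fin (h + h),
        (∏ j ∈ Finset.univ.erase k, (X (j, none) : MvPolynomial (Fin (h + h) × Option (Fin (h + h))) ℂ)) ^ 2 *
          X (k, some (Fin.castAdd h a)) * X (k, some (Fin.natAdd h c))) = 1 := by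
    ext a c
    rw [RingHom.mapMatrix_apply, Matrix.map_apply, Matrix.of_apply, map_sum, Matrix.one_apply]
    have eterm : ∀ k : Fin (h + h), eval θ₀ ((∏ j ∈ Finset.univ.erase k,
        (X (j, none) : MvPolynomial (Fin (h + h) × Option (Fin (h + h))) ℂ)) ^ 2 *
          X (k, some (Fin.castAdd h a)) * X (k, some (Fin.natAdd h c))) =
        (∏ _j ∈ Finset.univ.erase k, (1 : ℂ)) ^ 2 *
        (if (k : ℕ) < h ∧ (((Fin.castAdd h a : Fin (h + h)) : ℕ) = (k : ℕ) ∨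
            ((Fin.castAdd h a : Fin (h + h)) : ℕ) = h + (k : ℕ)) then (1 : ℂ) else 0) *
        (if (k : ℕ) < h ∧ (((Fin.natAdd h c : Fin (h + h)) : ℕ) = (k : ℕ) ∨
            ((Fin.natAdd h c : Fin (h + h)) : ℕ) = h + (k : ℕ)) then (1 : ℂ) else 0) := by
      intro k
      rw [map_mul, map_mul, map_pow, map_prod, eval_X, eval_X]
      have ep : ∏ j ∈ Finset.univ.erase k, eval θ₀ (X (j, none) :
          MvPolynomial (Fin (h + h) × Option (Fin (h + h))) ℂ) = ∏ _j ∈ Finset.univ.erase k, (1 : ℂ) :=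
        Finset.prod_congr rfl fun j _ => by rw [eval_X]; rfl
      rw [ep]
      rfl
    simp_rw [eterm]
    exact eval_testPoint_D a c
  rw [e1, e2, Matrix.det_one, one_mul] at e
  exact one_ne_zero e

/-! ## 2. No product of affine forms hits a starved layout -/

set_option maxHeartbeats 400000 in
/-- **No Chow witness for a starved layout.**  Rows: distinct, containing every set of size `≤ 2`;
columns: size `≤ 3`, no two distinct elements above `o`, triples entirely `≤ o`; `o + o < h` and
`3h < C(o+1, 2)`.  Then EVERY family of `h + h` polynomials of total degree `≤ 1` has vanishing
partition minor on the layout. -/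
theorem no_chow_witness (o : ℕ) {r : ℕ} (u w : Fin r → Finset (Fin h))
    (hu : Function.Injective u) (hcov : ∀ U : Finset (Fin h), U.card ≤ 2 → ∃ i, u i = U)
    (hw3 : ∀ j, (w j).card ≤ 3)
    (hwO : ∀ j, ∀ c ∈ w j, ∀ c' ∈ w j, c ≠ c' → (c : ℕ) ≤ o ∨ (c' : ℕ) ≤ o)
    (hwK : ∀ j, (w j).card = 3 → ∀ e ∈ w j, (e : ℕ) ≤ o)
    (hoh : o + o < h) (hcount : h + (h + h) < Nat.choose (o + 1) 2)
    (ℓ : Fin (h + h) → MvPolynomial (Fin (h + h)) ℂ) (hℓ : ∀ k, (ℓ k).totalDegree ≤ 1) :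
    (Matrix.of fun i j : Fin r => coeff (∑ a ∈ u i, Finsupp.single (Fin.castAdd h a) 1 + ∑ c ∈ w j, Finsupp.single (Fin.natAdd h c) 1) (∏ k, ℓ k)).det = 0 := by
  classical
  by_contra hne
  have hP := genericChow_det_ne_zero_of_hit u w ⟨ℓ, hℓ, hne⟩
  apply hP
  -- `P · Q = 0` with `Q ≠ 0`
  refine (mul_eq_zero.mp ?_).resolve_right (genericityPoly_ne_zero h)
  apply MvPolynomial.funext
  intro θ
  rw [map_zero, map_mul]
  by_cases hq : eval θ ((∏ k : Fin (h + h), (X (k, none) : MvPolynomial (Fin (h + h) × Option (Fin (h + h))) ℂ)) *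
      (Matrix.of fun a c : Fin h => ∑ k : Fin (h + h),
        (∏ j ∈ Finset.univ.erase k, (X (j, none) : MvPolynomial (Fin (h + h) × Option (Fin (h + h))) ℂ)) ^ 2 *
          X (k, some (Fin.castAdd h a)) * X (k, some (Fin.natAdd h c))).det) = 0
  · rw [hq, mul_zero]
  -- at `θ` all constants are nonzero and the rescaled coupling matrix is invertible
  rw [map_mul, map_prod, RingHom.map_det] at hq
  simp_rw [eval_X] at hq
  have hc : ∀ k, θ (k, none) ≠ 0 := fun k hk =>
    hq (by rw [Finset.prod_eq_zero (Finset.mem_univ k) hk, zero_mul])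
  have hD : ((RingHom.mapMatrix (eval θ)) (Matrix.of fun a c : Fin h => ∑ k : Fin (h + h),
        (∏ j ∈ Finset.univ.erase k, (X (j, none) : MvPolynomial (Fin (h + h) × Option (Fin (h + h))) ℂ)) ^ 2 *
          X (k, some (Fin.castAdd h a)) * X (k, some (Fin.natAdd h c)))).det ≠ 0 :=
    fun hz => hq (by rw [hz, mul_zero])
  -- the rescaled coefficient tables
  set A : Fin (h + h) → Fin h → ℂ := fun k a => θ (k, some (Fin.castAdd h a)) / θ (k, none) with hA
  set B : Fin (h + h) → Fin h → ℂ := fun k c => θ (k, some (Fin.natAdd h c)) / θ (k, none) with hB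
  set s : ℂ := ∏ k : Fin (h + h), θ (k, none) with hs
  have hdetM : (Matrix.of fun a c : Fin h => ∑ k, A k a * B k c).det ≠ 0 := by
    have hmat : (RingHom.mapMatrix (eval θ)) (Matrix.of fun a c : Fin h => ∑ k : Fin (h + h),
        (∏ j ∈ Finset.univ.erase k, (X (j, none) : MvPolynomial (Fin (h + h) × Option (Fin (h + h))) ℂ)) ^ 2 *
          X (k, some (Fin.castAdd h a)) * X (k, some (Fin.natAdd h c))) =
        (s ^ 2) • (Matrix.of fun a c : Fin h => ∑ k, A k a * B k c) := by
      ext a c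
      rw [RingHom.mapMatrix_apply, Matrix.map_apply, Matrix.of_apply, map_sum, Matrix.smul_apply,
        Matrix.of_apply, smul_eq_mul, Finset.mul_sum]
      refine Finset.sum_congr rfl fun k _ => ?_
      rw [map_mul, map_mul, map_pow, map_prod, eval_X, eval_X]
      simp_rw [eval_X]
      have ep : (∏ j ∈ Finset.univ.erase k, θ (j, none)) = s / θ (k, none) := by
        rw [eq_div_iff (hc k), hs, Finset.prod_erase_mul _ _ (Finset.mem_univ k)]
      rw [ep, hA, hB]
      simp only [div_eq_mul_inv]
      ring
    rw [hmat, Matrix.det_smul, Fintype.card_fin] at hD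
    exact fun hz => hD (by rw [hz, mul_zero])
  -- the concrete product is `C s · (product of forms with constant term 1)`
  rw [eval_det_coeff_genericChow θ u w]
  have hfac : ∀ k : Fin (h + h), (C (θ (k, none)) + ∑ v : Fin (h + h), C (θ (k, some v)) * X v :
      MvPolynomial (Fin (h + h)) ℂ) =
      C (θ (k, none)) * (C 1 + ∑ a, C (A k a) * X (Fin.castAdd h a) + ∑ c, C (B k c) * X (Fin.natAdd h c)) := by
    intro k
    have hx : ∑ a : Fin h, C (θ (k, none)) * (C (A k a) * X (Fin.castAdd h a)) =
        ∑ a : Fin h, (C (θ (k, some (Fin.castAdd h a))) * X (Fin.castAdd h a) :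
          MvPolynomial (Fin (h + h)) ℂ) := by
      refine Finset.sum_congr rfl fun a _ => ?_
      rw [← mul_assoc, ← C_mul]
      simp only [hA]
      rw [← mul_div_assoc, mul_div_cancel_left₀ _ (hc k)]
    have hy : ∑ c : Fin h, C (θ (k, none)) * (C (B k c) * X (Fin.natAdd h c)) =
        ∑ c : Fin h, (C (θ (k, some (Fin.natAdd h c))) * X (Fin.natAdd h c) :
          MvPolynomial (Fin (h + h)) ℂ) := by
      refine Finset.sum_congr rfl fun c _ => ?_
      rw [← mul_assoc, ← C_mul]
      simp only [hB]
      rw [← mul_div_assoc, mul_div_cancel_left₀ _ (hc k)]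
    rw [Fin.sum_univ_add, mul_add, mul_add, ← C_mul, mul_one, Finset.mul_sum, Finset.mul_sum, hx, hy,
      add_assoc]
  have hprod : (∏ k : Fin (h + h), (C (θ (k, none)) + ∑ v : Fin (h + h), C (θ (k, some v)) * X v :
      MvPolynomial (Fin (h + h)) ℂ)) = C s *
      ∏ k, ((C 1 + ∑ a, C (A k a) * X (Fin.castAdd h a) + ∑ c, C (B k c) * X (Fin.natAdd h c)) :
        MvPolynomial (Fin (h + h)) ℂ) := by
    rw [Finset.prod_congr rfl fun k _ => hfac k, Finset.prod_mul_distrib, ← map_prod C, hs]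
  have hM : (Matrix.of fun i j : Fin r => coeff (∑ a ∈ u i, Finsupp.single (Fin.castAdd h a) 1 + ∑ c ∈ w j, Finsupp.single (Fin.natAdd h c) 1)
      (∏ k : Fin (h + h), (C (θ (k, none)) + ∑ v : Fin (h + h), C (θ (k, some v)) * X v :
        MvPolynomial (Fin (h + h)) ℂ))) =
      s • (Matrix.of fun i j : Fin r => coeff (∑ a ∈ u i, Finsupp.single (Fin.castAdd h a) 1 + ∑ c ∈ w j, Finsupp.single (Fin.natAdd h c) 1)
        (∏ k, ((C 1 + ∑ a, C (A k a) * X (Fin.castAdd h a) + ∑ c, C (B k c) * X (Fin.natAdd h c)) :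
          MvPolynomial (Fin (h + h)) ℂ))) := by
    ext i j
    rw [Matrix.of_apply, Matrix.smul_apply, Matrix.of_apply, smul_eq_mul, hprod, coeff_C_mul]
  rw [hM, Matrix.det_smul, det_thinLayout_eq_zero_of_constOne o u w hu hcov hw3 hwO hwK hoh hcount A B
    hdetM, mul_zero, zero_mul]

end Summit.ValiantsHypothesis.ValiantsHypothesis.Theorems.BarrierLever.ChowStarve
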